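import Summits.Ventures.PercRepro.SixFourResidueThreeTwoPointsB

/-!
# The `t = 3` clause of `SixFourResidue` — plane + two points at `P = 7` (Theorem 21.6 at `t = 3`, `g ≤ 9`) (p2, gen 9)

`SixFourResidueThreeTwoPointsB.lean` proves Theorem 21.6 at `t = 3` for plane traces with `P ≤ 6` points (`g ≤ 8`).
At `P = 7` the crude demand count `#{B″ ∈ R₃(τ) : |B″| ≤ p − 3}` of `dem₃` fails the profile inequality on the
`6`-line + point profile (by `135/20`).  The REFINED count subtracts the sets `B″ = τ ∖ C` with `C ⊆ ℓ ∩ τ` for a line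
`ℓ` and `3 ≤ |C| ≤ |ℓ ∩ τ| − 2`: such a `B″` has rank `3` (two points of `ℓ` plus a point off `ℓ`), `|B″| + 3 ≤ p`, and
a collinear rest (`dem₃(B″) = 0`), and the pairs `(ℓ, C)` inject (`|C| ≥ 2` fixes the line).  Their number is
`Coll(τ) = Σ_m inc_m·Σ_{j=3}^{m−2} C(m, j) = 10·inc₅ + 35·inc₆` (`p ≤ 7`).  The `dem₂` count at `p = 7` also needs the
rank-`3` `5`-subsets (`card_five_eq`, `Dem2Prof7`).  The refined profile inequality

  `48·Dem₂ + 24·(Small − Coll) + 12·C(p,2) + 4·Col ≤ 39·T + 120·D₃ − 50·LP`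

holds on all `44` admissible pairwise-OK profiles with `p ≤ 7` (`profCheck3c_holds`; minimum slack `3` at `p = 3`,
`516` at `p = 7`).  Part C = the profile side and the counts (split for the `400`-line limit; the assembly
`J_three_nonneg_of_plane_add_two' : (P₀ ∩ G).card + 2 = G.card → G.card ≤ 9 → 0 ≤ J M G 3` is part D,
`SixFourResidueThreeTwoPointsD.lean`).
-/

namespace PercRepro.SixFour

/-! ## The profile side at `p ≤ 7` -/

/-- `r₃(τ,5) = C(p,5) − Σ_m C(m,5)·inc_m` for `p ≤ 7` (`C(5,5) = 1`, `C(6,5) = 6`). -/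
def r35Prof (p i5 i6 : ℕ) : ℕ := p.choose 5 - (i5 * 1 + i6 * 6)

/-- `#{B″ ∈ R₃(τ) : |B″| ≤ p − 2}` for `p ≤ 7`: the triples when `p ≥ 5`, the rank-`3` `4`-sets when `p ≥ 6` and the
rank-`3` `5`-sets when `p ≥ 7`. -/
def Dem2Prof7 (p i3 i4 i5 i6 : ℕ) : ℤ :=
  (if 5 ≤ p then TProf p i3 i4 i5 i6 else 0) + (if 6 ≤ p then (r34Prof p i4 i5 i6 : ℤ) else 0) +
    (if 7 ≤ p then (r35Prof p i5 i6 : ℤ) else 0)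

/-- `collCount m = Σ_{j=3}^{m−2} C(m, j)`: the subsets `C` of an `m`-set with `3 ≤ |C| ≤ m − 2`. -/
def collCount (m : ℕ) : ℕ := ∑ j ∈ (Finset.range (m + 1)).filter (fun j => 3 ≤ j ∧ j + 2 ≤ m), m.choose j

/-- `Coll = 10·inc₅ + 35·inc₆` (`collCount 5 = 10`, `collCount 6 = 35`, `collCount m = 0` for `m ≤ 4`). -/
def CollProf (i5 i6 : ℕ) : ℤ := i5 * 10 + i6 * 35

/-- The refined profile inequality of Theorem 21.6 at `t = 3` (scaled by `20`). -/
def ProfIneq3c (p i3 i4 i5 i6 : ℕ) : Prop :=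
  48 * Dem2Prof7 p i3 i4 i5 i6 + 24 * (SmallProf p i3 i4 i5 i6 - CollProf i5 i6) + 12 * (p.choose 2 : ℤ) +
      4 * ColProf i3 i4 i5 i6 ≤
    39 * TProf p i3 i4 i5 i6 + 120 * (D3Prof p i4 i5 i6 : ℤ) - 50 * LPProf p i3 i4 i5 i6

/-- `ProfIneq3c` is decidable. -/
instance (p i3 i4 i5 i6 : ℕ) : Decidable (ProfIneq3c p i3 i4 i5 i6) := by unfold ProfIneq3c; infer_instance

/-- The finite check: every admissible, pairwise-OK profile with `p ≤ 7` satisfies the refined inequality. -/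
def profCheck3c : Prop := ∀ p < 8, ∀ i3 < 8, ∀ i4 < 4, ∀ i5 < 3, ∀ i6 < 2,
  (!decide (ProfileOK p (p.choose 2 - (3 * i3 + 6 * i4 + 10 * i5 + 15 * i6)) i3 i4 i5 i6 ∧ PairOK p i3 i4 i5 i6) ||
    decide (ProfIneq3c p i3 i4 i5 i6)) = true

/-- The finite check holds (`44` profiles; minimum slack `3` at `p = 3`, `516` at `p = 7`). -/
theorem profCheck3c_holds : profCheck3c := by
  unfold profCheck3c
  decide

/-- **The refined `t = 3`, `k = 2` profile inequality** for every admissible, pairwise-OK profile with `p ≤ 7`. -/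
theorem profIneq3c_of_profileOK {p i2 i3 i4 i5 i6 : ℕ} (hp : p ≤ 7) (h3 : i3 < 8) (h4 : i4 < 4) (h5 : i5 < 3)
    (h6 : i6 < 2) (hok : ProfileOK p i2 i3 i4 i5 i6) (hpair : PairOK p i3 i4 i5 i6) : ProfIneq3c p i3 i4 i5 i6 := by
  have hi2 : i2 = p.choose 2 - (3 * i3 + 6 * i4 + 10 * i5 + 15 * i6) := by
    have := hok.1
    omega
  subst hi2
  have h := profCheck3c_holds p (by omega) i3 h3 i4 h4 i5 h5 i6 h6
  rw [Bool.or_eq_true, Bool.not_eq_true', decide_eq_false_iff_not, decide_eq_true_eq] at h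
  exact h.resolve_left (not_not.2 ⟨hok, hpair⟩)

/-! ## The counts -/

open Finset ThmH
variable {α : Type*} [DecidableEq α] {M : Matroid α} [M.Finite] {G : Finset α}

omit [DecidableEq α] in
/-- The subsets `C` of `X` with `3 ≤ |C| ≤ |X| − 2` number `collCount |X|`. -/
theorem card_powerset_filter_coll (X : Finset α) :
    (X.powerset.filter (fun C : Finset α => 3 ≤ C.card ∧ C.card + 2 ≤ X.card)).card = collCount X.card := by
  rw [Finset.powerset_card_disjiUnion, Finset.filter_disjiUnion, Finset.card_disjiUnion]
  have hterm : ∀ i ∈ Finset.range (X.card + 1),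
      ((X.powersetCard i).filter (fun C : Finset α => 3 ≤ C.card ∧ C.card + 2 ≤ X.card)).card =
        if 3 ≤ i ∧ i + 2 ≤ X.card then X.card.choose i else 0 := by
    intro i _
    split_ifs with hi
    · rw [Finset.filter_true_of_mem, Finset.card_powersetCard]
      intro C hC
      rw [(Finset.mem_powersetCard.1 hC).2]
      exact hi
    · rw [Finset.card_eq_zero, Finset.filter_false_of_mem]
      intro C hC
      rw [(Finset.mem_powersetCard.1 hC).2]
      exact hi
  rw [Finset.sum_congr rfl hterm]
  unfold collCount
  rw [Finset.sum_filter]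

section Counts

variable (hs : Simple M) {τ : Finset α} (hτ : τ ⊆ gr M)
include hs hτ

/-- `#{S ∈ R₃(τ) : |S| = 5} = r35Prof` for `p ≤ 7` (the `5`-subsets of `τ` have rank `3` or `2`, and the rank-`2`
ones lie on a unique line). -/
theorem card_five_eq (hr : M.eRk (τ : Set α) = 3) (h7 : τ.card ≤ 7) :
    ((R3 M τ).filter (fun S => S.card = 5)).card = r35Prof τ.card (inc M τ 5) (inc M τ 6) := by
  have e1 : ((R3 M τ).filter (fun S => S.card = 5)).card =
      ((τ.powersetCard 5).filter (fun Z : Finset α => M.eRk (Z : Set α) = 3)).card := by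
    unfold R3
    rw [Finset.powersetCard_eq_filter, Finset.filter_filter, Finset.filter_filter]
    congr 1
    exact Finset.filter_congr (fun Z _ => and_comm)
  have hsplit := Finset.card_filter_add_card_filter_not (s := τ.powersetCard 5)
    (fun Z : Finset α => M.eRk (Z : Set α) = 3)
  have hcongr : (τ.powersetCard 5).filter (fun Z : Finset α => ¬ M.eRk (Z : Set α) = 3) =
      (τ.powersetCard 5).filter (fun Z : Finset α => M.eRk (Z : Set α) = 2) := by
    refine Finset.filter_congr (fun Z hZ => ?_)
    obtain ⟨hZτ, hc⟩ := Finset.mem_powersetCard.1 hZ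
    have hle : M.eRk (Z : Set α) ≤ 3 := by rw [← hr]; exact M.eRk_mono (Finset.coe_subset.2 hZτ)
    constructor
    · intro hne
      refine le_antisymm ?_ (two_le_eRk_of_two_le_card hs hτ hZτ (by omega))
      by_contra h
      exact hne (eRk_eq_of_le_of_not_le (n := 2) hle h)
    · intro h2; rw [h2]; decide
  rw [hcongr, card_rank_two_subsets hs hτ (by norm_num : 2 ≤ 5), Finset.card_powersetCard] at hsplit
  have e5 := sum_lines_eq_sum_inc (M := M) τ (fun n => n.choose 5)
  rw [e5, sum_inc_range_eight hr h7] at hsplit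
  have hi7 : inc M τ 7 = 0 := inc_eq_zero_of_card_le hr (by omega)
  have hc : Nat.choose 0 5 = 0 ∧ Nat.choose 1 5 = 0 ∧ Nat.choose 2 5 = 0 ∧ Nat.choose 3 5 = 0 ∧ Nat.choose 4 5 = 0 ∧
      Nat.choose 5 5 = 1 ∧ Nat.choose 6 5 = 6 := by decide
  obtain ⟨c0, c1, c2, c3, c4, c5, c6⟩ := hc
  simp only [Finset.sum_range_succ, Finset.sum_range_zero, c0, c1, c2, c3, c4, c5, c6, hi7, mul_zero, zero_add,
    mul_one, zero_mul, add_zero] at hsplit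
  unfold r35Prof
  rw [e1]
  omega

/-- **The `dem₂`-demanded sets are small, `p ≤ 7`**: `#{S ∈ R₃(τ) : |S| + 2 ≤ p} ≤ Dem2Prof7`. -/
theorem card_dem2_le_Dem2Prof7 (hr3 : M.eRk (τ : Set α) = 3) (h7 : τ.card ≤ 7) :
    ((((R3 M τ).filter (fun S => S.card + 2 ≤ τ.card)).card : ℕ) : ℤ) ≤
      Dem2Prof7 τ.card (inc M τ 3) (inc M τ 4) (inc M τ 5) (inc M τ 6) := by
  unfold Dem2Prof7
  rw [← Tcnt_eq hs hτ hr3 h7, ← card_four_eq hs hτ hr3 h7, ← card_five_eq hs hτ hr3 h7]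
  have hsub : (R3 M τ).filter (fun S => S.card + 2 ≤ τ.card) ⊆
      ((R3 M τ).filter (fun S => S.card = 3 ∧ 5 ≤ τ.card)) ∪ ((R3 M τ).filter (fun S => S.card = 4 ∧ 6 ≤ τ.card)) ∪
        ((R3 M τ).filter (fun S => S.card = 5 ∧ 7 ≤ τ.card)) := by
    intro S hS
    rw [Finset.mem_filter] at hS
    rw [Finset.mem_union, Finset.mem_union, Finset.mem_filter, Finset.mem_filter, Finset.mem_filter]
    have h3 : 3 ≤ S.card := three_le_card_of_eRk_eq_three (mem_R3.1 hS.1).2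
    rcases (show S.card = 3 ∨ S.card = 4 ∨ S.card = 5 by omega) with h | h | h
    · exact Or.inl (Or.inl ⟨hS.1, h, by omega⟩)
    · exact Or.inl (Or.inr ⟨hS.1, h, by omega⟩)
    · exact Or.inr ⟨hS.1, h, by omega⟩
  have h1 : ((R3 M τ).filter (fun S => S.card = 3 ∧ 5 ≤ τ.card)).card = if 5 ≤ τ.card then Tcnt M τ else 0 := by
    split_ifs with h5
    · unfold Tcnt
      congr 1
      exact Finset.filter_congr (fun S _ => by simp [h5])
    · rw [Finset.card_eq_zero, Finset.filter_eq_empty_iff]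
      intro S _ h
      exact h5 h.2
  have h2 : ((R3 M τ).filter (fun S => S.card = 4 ∧ 6 ≤ τ.card)).card =
      if 6 ≤ τ.card then ((R3 M τ).filter (fun S => S.card = 4)).card else 0 := by
    split_ifs with h6'
    · congr 1
      exact Finset.filter_congr (fun S _ => by simp [h6'])
    · rw [Finset.card_eq_zero, Finset.filter_eq_empty_iff]
      intro S _ h
      exact h6' h.2
  have h3 : ((R3 M τ).filter (fun S => S.card = 5 ∧ 7 ≤ τ.card)).card =
      if 7 ≤ τ.card then ((R3 M τ).filter (fun S => S.card = 5)).card else 0 := by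
    split_ifs with h7'
    · congr 1
      exact Finset.filter_congr (fun S _ => by simp [h7'])
    · rw [Finset.card_eq_zero, Finset.filter_eq_empty_iff]
      intro S _ h
      exact h7' h.2
  have hle : ((R3 M τ).filter (fun S => S.card + 2 ≤ τ.card)).card ≤
      ((R3 M τ).filter (fun S => S.card = 3 ∧ 5 ≤ τ.card)).card +
        ((R3 M τ).filter (fun S => S.card = 4 ∧ 6 ≤ τ.card)).card +
        ((R3 M τ).filter (fun S => S.card = 5 ∧ 7 ≤ τ.card)).card :=
    (Finset.card_le_card hsub).trans ((Finset.card_union_le _ _).trans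
      (add_le_add_left (Finset.card_union_le _ _) _))
  rw [h1, h2, h3] at hle
  have hz := (Nat.cast_le (α := ℤ)).2 hle
  push_cast at hz
  split_ifs at hz ⊢ <;> linarith

/-- The pairs `(ℓ, C)`: a line `ℓ` and `C ⊆ ℓ ∩ τ` with `3 ≤ |C| ≤ |ℓ ∩ τ| − 2`. -/
noncomputable def collPairs (M : Matroid α) [M.Finite] (τ : Finset α) : Finset (Σ _ : Finset α, Finset α) :=
  (lines M).sigma (fun L => (L ∩ τ).powerset.filter (fun C : Finset α => 3 ≤ C.card ∧ C.card + 2 ≤ (L ∩ τ).card))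

omit hs hτ in
/-- `#collPairs = Σ_m inc_m·collCount m = 10·inc₅ + 35·inc₆` for a rank-`3` trace with `p ≤ 7`. -/
theorem card_collPairs (hr : M.eRk (τ : Set α) = 3) (h7 : τ.card ≤ 7) :
    ((collPairs M τ).card : ℤ) = CollProf (inc M τ 5) (inc M τ 6) := by
  have hT : (collPairs M τ).card = ∑ L ∈ lines M, collCount (L ∩ τ).card := by
    unfold collPairs
    rw [Finset.card_sigma]
    refine Finset.sum_congr rfl (fun L _ => ?_)
    rw [card_powerset_filter_coll]
  have e := sum_lines_eq_sum_inc (M := M) τ (fun n => collCount n)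
  rw [e, sum_inc_range_eight hr h7] at hT
  have hi7 : inc M τ 7 = 0 := inc_eq_zero_of_card_le hr (by omega)
  have hc : collCount 0 = 0 ∧ collCount 1 = 0 ∧ collCount 2 = 0 ∧ collCount 3 = 0 ∧ collCount 4 = 0 ∧
      collCount 5 = 10 ∧ collCount 6 = 35 := by decide
  obtain ⟨c0, c1, c2, c3, c4, c5, c6⟩ := hc
  simp only [Finset.sum_range_succ, Finset.sum_range_zero, c0, c1, c2, c3, c4, c5, c6, hi7, mul_zero, zero_add,
    zero_mul, add_zero] at hT
  unfold CollProf
  rw [hT]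
  push_cast
  ring

/-- The collinear-complement sets: `τ ∖ C` for `(ℓ, C) ∈ collPairs` lies in `R₃(τ)`, has `|τ ∖ C| + 3 ≤ p` and a rest
`C` of rank `2` (so `dem₃ = 0`). -/
theorem sdiff_mem_of_collPair (hr : M.eRk (τ : Set α) = 3) {q : Σ _ : Finset α, Finset α} (hq : q ∈ collPairs M τ) :
    τ \ q.2 ∈ (R3 M τ).filter (fun S => S.card + 3 ≤ τ.card ∧ M.eRk ((τ \ S : Finset α) : Set α) + 1 ≤ 3) := by
  obtain ⟨L, C⟩ := q
  unfold collPairs at hq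
  rw [Finset.mem_sigma, Finset.mem_filter, Finset.mem_powerset] at hq
  dsimp only at hq ⊢
  obtain ⟨hL, hCL, hC3, hC2⟩ := hq
  have hCτ : C ⊆ τ := hCL.trans Finset.inter_subset_right
  have hCL' : C ⊆ L := hCL.trans Finset.inter_subset_left
  have hL' := mem_lines.1 hL
  -- a point of `τ` off `L`
  have hnot : ¬ τ ⊆ L := by
    intro h
    have := M.eRk_mono (Finset.coe_subset.2 h)
    rw [hr, hL'.2.2] at this
    have h32 : (3 : ℕ) ≤ 2 := by exact_mod_cast this
    omega
  obtain ⟨x, hxτ, hxL⟩ := Finset.not_subset.1 hnot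
  -- two points of `(L ∩ τ) ∖ C`
  have hcard2 : 2 ≤ ((L ∩ τ) \ C).card := by
    rw [Finset.card_sdiff_of_subset hCL]
    omega
  obtain ⟨y, hy, y', hy', hyy'⟩ := Finset.one_lt_card.1 (by omega : 1 < ((L ∩ τ) \ C).card)
  rw [Finset.mem_sdiff, Finset.mem_inter] at hy hy'
  have hsub2 : ({y, y'} : Finset α) ⊆ L := by
    intro z hz
    rw [Finset.mem_insert, Finset.mem_singleton] at hz
    rcases hz with rfl | rfl
    · exact hy.1.1
    · exact hy'.1.1
  have hr2 : M.eRk (({y, y'} : Finset α) : Set α) = 2 :=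
    eRk_eq_two_of_subset_line hs hL hsub2 (by rw [Finset.card_pair hyy'])
  have hcl := closure_eq_of_subset_line hL hsub2 hr2
  have hxE : x ∈ M.E := by rw [← coe_gr]; exact_mod_cast hτ hxτ
  have hxcl : x ∉ M.closure (({y, y'} : Finset α) : Set α) := by
    rw [hcl]; exact fun h => hxL (Finset.mem_coe.1 h)
  have hr3 : M.eRk ((insert x {y, y'} : Finset α) : Set α) = 3 := by
    rw [Finset.coe_insert, Matroid.eRk_insert_eq_add_one ⟨hxE, hxcl⟩, hr2]
    norm_num
  have hsub3 : (insert x {y, y'} : Finset α) ⊆ τ \ C := by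
    intro z hz
    rw [Finset.mem_insert, Finset.mem_insert, Finset.mem_singleton] at hz
    rw [Finset.mem_sdiff]
    rcases hz with rfl | rfl | rfl
    · exact ⟨hxτ, fun h => hxL (hCL' h)⟩
    · exact ⟨hy.1.2, hy.2⟩
    · exact ⟨hy'.1.2, hy'.2⟩
  rw [Finset.mem_filter, mem_R3]
  refine ⟨⟨Finset.sdiff_subset, le_antisymm ?_ ?_⟩, ?_, ?_⟩
  · rw [← hr]; exact M.eRk_mono (Finset.coe_subset.2 Finset.sdiff_subset)
  · rw [← hr3]; exact M.eRk_mono (Finset.coe_subset.2 hsub3)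
  · have := Finset.card_le_card hCτ
    rw [Finset.card_sdiff_of_subset hCτ]
    omega
  · rw [Finset.sdiff_sdiff_eq_self hCτ]
    calc M.eRk (C : Set α) + 1 ≤ M.eRk (L : Set α) + 1 := add_le_add_left (M.eRk_mono (Finset.coe_subset.2 hCL')) 1
      _ = 3 := by rw [hL'.2.2]; norm_num

omit hτ in
/-- The map `(ℓ, C) ↦ τ ∖ C` is injective on `collPairs` (`C` is recovered as `τ ∖ (τ ∖ C)`, and `|C| ≥ 3` fixes `ℓ`). -/
theorem collPairs_injOn :
    Set.InjOn (fun q : Σ _ : Finset α, Finset α => τ \ q.2) ((collPairs M τ : Finset _) : Set _) := by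
  rintro ⟨L, C⟩ hq ⟨L', C'⟩ hq' heq
  rw [Finset.mem_coe] at hq hq'
  unfold collPairs at hq hq'
  rw [Finset.mem_sigma, Finset.mem_filter, Finset.mem_powerset] at hq hq'
  dsimp only at hq hq' heq
  obtain ⟨hL, hCL, hC3, -⟩ := hq
  obtain ⟨hL', hCL', -, -⟩ := hq'
  have hCτ : C ⊆ τ := hCL.trans Finset.inter_subset_right
  have hC'τ : C' ⊆ τ := hCL'.trans Finset.inter_subset_right
  have hCC : C = C' := by
    have h := congrArg (fun S => τ \ S) heq
    simp only [Finset.sdiff_sdiff_eq_self hCτ, Finset.sdiff_sdiff_eq_self hC'τ] at h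
    exact h
  subst hCC
  obtain ⟨a, ha, b, hb, hab⟩ := Finset.one_lt_card.1 (by omega : 1 < C.card)
  have hLL : L = L' := lines_eq_of_two_mem hs hL hL' (Finset.mem_inter.1 (hCL ha)).1 (Finset.mem_inter.1 (hCL hb)).1
    (Finset.mem_inter.1 (hCL' ha)).1 (Finset.mem_inter.1 (hCL' hb)).1 hab
  subst hLL
  rfl

/-- **The refined `dem₃` count**: `Σ_{S ∈ R₃(τ)} dem₃(S) + Coll ≤ #{S ∈ R₃(τ) : |S| + 3 ≤ p}` for a rank-`3` trace with
`p ≤ 7`: the demanded sets and the collinear-complement sets are disjoint subfamilies of the small sets. -/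
theorem dem3_sum_add_coll_le (hr : M.eRk (τ : Set α) = 3) (h7 : τ.card ≤ 7) :
    ∑ S ∈ R3 M τ, dem3 M τ S + (CollProf (inc M τ 5) (inc M τ 6) : ℚ) ≤
      (((R3 M τ).filter (fun S => S.card + 3 ≤ τ.card)).card : ℚ) := by
  set A := (R3 M τ).filter (fun S => S.card + 3 ≤ τ.card) with hA
  set q : Finset α → Prop := fun S => M.eRk ((τ \ S : Finset α) : Set α) + 1 ≤ 3 with hqdef
  -- the demanded sets are the `¬ q` members of `A`
  have hdem : ∑ S ∈ R3 M τ, dem3 M τ S ≤ ((A.filter (fun S => ¬ q S)).card : ℚ) := by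
    have hpt : ∀ S ∈ R3 M τ, dem3 M τ S ≤ (if S.card + 3 ≤ τ.card ∧ ¬ q S then (1 : ℚ) else 0) := by
      intro S hS
      obtain ⟨hSτ, -⟩ := mem_R3.1 hS
      unfold dem3
      split_ifs with h1 h2 h2
      · norm_num
      · norm_num
      · norm_num
      · exfalso
        apply h2
        refine ⟨?_, h1⟩
        by_contra hc
        apply h1
        have hle := M.eRk_le_encard ((τ \ S : Finset α) : Set α)
        rw [Set.encard_coe_eq_coe_finsetCard, Finset.card_sdiff_of_subset hSτ] at hle
        have hc' : τ.card - S.card ≤ 2 := by omega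
        calc M.eRk ((τ \ S : Finset α) : Set α) + 1 ≤ ((τ.card - S.card : ℕ) : ℕ∞) + 1 := add_le_add_left hle 1
          _ ≤ ((2 : ℕ) : ℕ∞) + 1 := add_le_add_left (by exact_mod_cast hc') 1
          _ = 3 := by norm_num
    refine (Finset.sum_le_sum hpt).trans ?_
    rw [Finset.sum_ite, Finset.sum_const, Finset.sum_const_zero, add_zero, nsmul_eq_mul, mul_one]
    rw [hA, Finset.filter_filter]
  -- the collinear-complement sets are `q` members of `A`
  have hcoll : (CollProf (inc M τ 5) (inc M τ 6) : ℚ) ≤ ((A.filter q).card : ℚ) := by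
    have h1 : (collPairs M τ).card ≤ (A.filter q).card := by
      refine Finset.card_le_card_of_injOn (fun p : Σ _ : Finset α, Finset α => τ \ p.2) (fun p hp => ?_)
        (collPairs_injOn hs)
      rw [Finset.mem_coe] at hp
      have := sdiff_mem_of_collPair hs hτ hr hp
      rw [Finset.mem_filter] at this
      show τ \ p.2 ∈ ((A.filter q : Finset (Finset α)) : Set (Finset α))
      rw [Finset.mem_coe, Finset.mem_filter, hA, Finset.mem_filter]
      exact ⟨⟨this.1, this.2.1⟩, this.2.2⟩
    have h2 := card_collPairs hr h7
    have h1' : ((collPairs M τ).card : ℤ) ≤ ((A.filter q).card : ℤ) := by exact_mod_cast h1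
    rw [h2] at h1'
    exact_mod_cast h1'
  have hsplit : (A.filter q).card + (A.filter (fun S => ¬ q S)).card = A.card :=
    Finset.card_filter_add_card_filter_not (s := A) q
  have hsplit' : ((A.filter q).card : ℚ) + ((A.filter (fun S => ¬ q S)).card : ℚ) = (A.card : ℚ) := by
    exact_mod_cast hsplit
  linarith

end Counts

end PercRepro.SixFour
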